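import Summits.ResolutionOfSingularities.ResolutionOfSingularities.Theorems.PurelyInseparableDim4UnitClassOrderLemmas
import HarnessLib
import HarnessLib.Audit.Tags

/-!
# Purely inseparable four-folds — THE ORDER OF THE TRANSLATION PART OF A UNIT-CLASS SUBSTITUTION BETWEEN TWO FRAMED
# PRESENTATIONS: straight at both ends ⇒ no linear terms (`s = 2`); Tschirnhaus at degree `d + 1` at both ends ⇒ no
# `x_f`-free quadratic terms (`s = 3`) (cell `res-dim4-pi`, K2(p) lane, slice B, brick «UnitClassOrder», FILE A2)

[OURS · counted 0 · cell `res-dim4-pi` · K2(p) lane (holder res-dim4-p-12 g3, scope word 2026-08-29T04:43:23Z) · seat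
res-dim4-p-7 g4 · consumer res-dim4-p-1 g4 (K24a-R1′(β) `R1c`, «s = 3 is exactly what R1c consumes», 04:39:13Z).]  Nothing
here proves K2(p)/K2(5), `NoIsolatedTrap p p`, or resolution of singularities in dimension ≥ 4 / characteristic `p`.  AI
kernel work, weaker than expert review.

Setting (SN3/SN3b letters, as in `…UnitClassTransfer`): `θ(x_{π i}) = x_i · e_i` (`i ≠ f`), `θ(x_{π f}) = x_f · e_f + G`,
`e_i(0) ≠ 0`, `G(0) = 0`, no `x_f`-term in `G`; a re-presentation `F_B = clean_q(V · θ F_A) + D`, `V(0) ≠ 0`, `D ∈ 𝔪₀ᴹ`.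
`F_A` is PRESENTED with boundary `r` (`r (π f) = 0`) and a residual of order `d` whose degree-`d` part is the pure power
`a · x_{π f}^d` (STRAIGHT at `π f`); `n♯ = n.mapDomain π⁻¹`, `r♯` the transported boundary.

Over FILE A1 (`…UnitClassOrderLemmas`: `coeff_of_rel_of_lower`, `coeff_pred_mul_X_mul_add_pow`, supports of `G^k`) and
`…UnitClassTransfer` (`aeval_monomial_unitClass`, `support_aeval_monomial`, `coeff_aeval_unitClass`):
* §1 **`coeff_linear_eq_zero_of_straight`** (`s = 2`): if `F_B` is straight at `f` in degree `|r| + d` (its coefficients at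
  `r♯ + (d−1)·e_f + e_i`, `i ≠ f`, vanish), `(d : K) ≠ 0`, those exponents are not `q`-th powers and `|r| + d < M`, then
  `coeff_{e_i} G = 0` for all `i ≠ f`.
* §2 **`coeff_quadratic_eq_zero_of_tschirnhaus`** (`s = 3`): if moreover both ends are TSCHIRNHAUS at degree `d + 1` (no
  `x^{r} · Y^{d-1} · (quadratic off Y)` at `A`, no `x^{r♯} · x_f^{d-1} · (quadratic off f)` at `B`) and `|r| + d + 1 < M`,
  then `coeff_{e_i + e_k} G = 0` for all `i, k ≠ f`; **`three_le_degree_of_frames`** packages `s = 3` in the form the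
  transfer theorem `SwapNorm.coeff_aeval_unitClass` consumes (`∀ dd ∈ G.support, dd f = 0 → 3 ≤ dd.degree`).

`s ≥ 4` is NOT forced (units carrying `x_f`; example in `…UnitClassTransfer`).  `d`-generic, characteristic-free.
[cite: Abhyankar1990, Lecture 25 pp. 216–217] [cite: Hauser2010, §§F–G (cleaning)] [folklore]
bears_on: LADDER-RESOLUTION:D157-DOOR2 (res-dim4-pi · K2(p) · slice B · UnitClassOrder A2).  Supports
stmt-ResolutionOfSingularities-16155 (helper).
-/

set_option linter.dupNamespace false -- mandated namespace of this single-conjunct summit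

noncomputable section

namespace Summit.ResolutionOfSingularities.ResolutionOfSingularities.Theorems.PIDim4

namespace SwapNorm

open MvPolynomial Finset
open Literature.AlgebraicGeometry.Resolution
open Literature.AlgebraicGeometry.Resolution.Hauser2010

variable {K : Type} [Field K]

/-! ## §1 Straight at both ends ⇒ no linear terms in `G` off `f` (`s = 2`) -/

section Frames

variable {π : Equiv.Perm (Fin 4)} {f : Fin 4} {θ e : Fin 4 → MvPolynomial (Fin 4) K} {G : MvPolynomial (Fin 4) K}

/-- The boundary of the cone monomial: `(r + d·e_{πf}).erase (π f) = r` when `r (π f) = 0`. [folklore] -/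
theorem erase_add_single_self {r : Fin 4 →₀ ℕ} {g : Fin 4} (hrg : r g = 0) (d : ℕ) :
    (r + Finsupp.single g d).erase g = r := by
  classical
  ext l
  rw [Finsupp.erase_apply]
  split_ifs with h
  · rw [h, hrg]
  · rw [Finsupp.add_apply, Finsupp.single_eq_of_ne h, add_zero]

/-- `θ` of the cone monomial `a · x^{r + d·e_{πf}}`: `C a · (x^{r♯} · ∏_{i≠f} e_i^{r(πi)}) · (x_f e_f + G)^d`. [folklore] -/
theorem aeval_cone_monomial (hθi : ∀ i, i ≠ f → θ (π i) = X i * e i) (hθf : θ (π f) = X f * e f + G)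
    {r : Fin 4 →₀ ℕ} (hrf : r (π f) = 0) (d : ℕ) (a : K) :
    aeval θ (monomial (r + Finsupp.single (π f) d) a) =
      C a * ((monomial (Finsupp.mapDomain π.symm r) 1 * ∏ i ∈ univ.erase f, e i ^ r (π i)) * (X f * e f + G) ^ d) := by
  rw [aeval_monomial_unitClass hθi hθf, erase_add_single_self hrf]
  congr 3
  · refine prod_congr rfl fun i hi => ?_
    rw [Finsupp.add_apply, Finsupp.single_eq_of_ne (fun h => ne_of_mem_erase hi (π.injective h)), add_zero]
  · rw [Finsupp.add_apply, hrf, Finsupp.single_eq_same, zero_add]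

/-- **STRAIGHT AT BOTH ENDS ⇒ THE TRANSLATION PART HAS NO LINEAR TERMS OFF `f`.**  See the module docstring: the
coefficient of `x^{r♯} · x_f^{d-1} x_i` in `F_B` is `V(0) · a · d · E(0) · e_f(0)^{d-1} · coeff_{e_i} G`.
[cite: Abhyankar1990, Lecture 25 pp. 216–217] [folklore] -/
theorem coeff_linear_eq_zero_of_straight (q : ℕ) (hθi : ∀ i, i ≠ f → θ (π i) = X i * e i)
    (hθf : θ (π f) = X f * e f + G) (he : ∀ i, constantCoeff (e i) ≠ 0) (hG0 : constantCoeff G = 0)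
    (hG1 : coeff (Finsupp.single f 1) G = 0) {V D F_A F_B : MvPolynomial (Fin 4) K} {M : ℕ}
    (hV : constantCoeff V ≠ 0) (hD : D ∈ originIdeal K ^ M) (hrel : F_B = deletePthPowers q (V * aeval θ F_A) + D)
    {r : Fin 4 →₀ ℕ} {d : ℕ} (hd : 1 ≤ d) (hdK : (d : K) ≠ 0) (hrf : r (π f) = 0)
    (hA : ∀ m ∈ F_A.support, r.degree + d ≤ m.degree)
    (hAcone : ∀ m ∈ F_A.support, m.degree = r.degree + d → m = r + Finsupp.single (π f) d)
    (ha : coeff (r + Finsupp.single (π f) d) F_A ≠ 0) (hM : r.degree + d < M)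
    (hnq : ∀ i, i ≠ f →
      ¬ IsPthPowerExponent q (Finsupp.mapDomain π.symm r + Finsupp.single f (d - 1) + Finsupp.single i 1))
    (hB : ∀ i, i ≠ f →
      coeff (Finsupp.mapDomain π.symm r + Finsupp.single f (d - 1) + Finsupp.single i 1) F_B = 0) :
    ∀ i, i ≠ f → coeff (Finsupp.single i 1) G = 0 := by
  classical
  intro i hif
  have hθ0 := unitClass_origin hθi hθf hG0
  set ms := r + Finsupp.single (π f) d with hms
  set a := coeff ms F_A with ha'
  set t := Finsupp.mapDomain π.symm r + Finsupp.single f (d - 1) + Finsupp.single i 1 with ht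
  have htdeg : t.degree = r.degree + d := by
    rw [ht, map_add, map_add, ResCone.degree_mapDomain_perm, Finsupp.degree_single, Finsupp.degree_single]; omega
  -- the remainder past the cone is invisible at `t`
  have hR : F_A - monomial ms a ∈ originIdeal K ^ (r.degree + d + 1) := sub_monomial_mem_pow hA hAcone
  have hθR : ∀ b : Fin 4 →₀ ℕ, b.degree ≤ r.degree + d → coeff b (aeval θ (F_A - monomial ms a)) = 0 := fun b hb =>
    (IsolationCert.mem_originIdeal_pow_iff _ _).mp (aeval_mem_pow hθ0 hR) b (by omega)
  have hθA : ∀ b : Fin 4 →₀ ℕ, b.degree < r.degree + d → coeff b (aeval θ F_A) = 0 := fun b hb =>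
    (IsolationCert.mem_originIdeal_pow_iff _ _).mp
      (aeval_mem_pow hθ0 ((IsolationCert.mem_originIdeal_pow_iff _ F_A).mpr fun dd hdd => by
        by_contra hne; exact absurd (hA dd (mem_support_iff.mpr hne)) (by omega))) b hb
  -- coefficient of `t` in `F_B`
  have h1 : coeff t F_B = constantCoeff V * coeff t (aeval θ F_A) :=
    coeff_of_rel_of_lower q hD hrel (by omega) (hnq i hif) fun b hb hbt =>
      hθA b (by rw [← htdeg]; exact degree_lt_of_le_of_ne hb hbt)
  have h2 : coeff t (aeval θ F_A) = coeff t (aeval θ (monomial ms a)) := by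
    have : F_A = monomial ms a + (F_A - monomial ms a) := by ring
    conv_lhs => rw [this, map_add, coeff_add, hθR t (by omega), add_zero]
  have h3 : coeff t (aeval θ (monomial ms a)) =
      a * (d * (constantCoeff (∏ i ∈ univ.erase f, e i ^ r (π i)) * constantCoeff (e f) ^ (d - 1) *
        coeff (Finsupp.single i 1) G)) := by
    rw [hms, aeval_cone_monomial hθi hθf hrf, coeff_C_mul, mul_assoc, ht, add_assoc, coeff_monomial_mul, one_mul,
      coeff_pred_mul_X_mul_add_pow f _ (e f) G hd (Finsupp.single_eq_of_ne hif.symm)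
        (fun v hv => by
          rw [Finsupp.degree_single] at hv
          rw [(Finsupp.degree_eq_zero_iff v).mp (by omega), ← constantCoeff_eq, hG0])
        (fun H k v hk _ hdeg hvf => hvan_of_linearFree hG0 hG1 H k v hk
          (by rw [Finsupp.degree_single] at hdeg; exact hdeg) hvf)]
  have hE : ∏ i ∈ univ.erase f, constantCoeff (e i) ^ r (π i) ≠ 0 :=
    prod_ne_zero_iff.mpr fun j _ => pow_ne_zero _ (he j)
  have h := hB i hif
  rw [h1, h2, h3] at h
  simpa [hV, ha, hdK, hE, he f] using h

/-! ## §2 Tschirnhaus at degree `d + 1` at both ends ⇒ no `x_f`-free quadratic terms in `G` (`s = 3`) -/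

/-- **TSCHIRNHAUS AT BOTH ENDS ⇒ THE `x_f`-FREE QUADRATIC PART OF `G` VANISHES.**  See the module docstring: with the
linear part of `G` already zero (§1), the coefficient of `x^{r♯} · x_f^{d-1} x_i x_k` in `F_B` is
`V(0) · (a · d · E(0) e_f(0)^{d-1} · coeff_{e_i+e_k} G + (∏ e(0)^{…}) · coeff_{r + (d-1)e_{πf} + e_{πi} + e_{πk}} F_A)`,
and the last coefficient is a Tschirnhaus zero of `A`. [cite: Abhyankar1990, Lecture 25 pp. 216–217] [folklore] -/
theorem coeff_quadratic_eq_zero_of_tschirnhaus (q : ℕ) (hθi : ∀ i, i ≠ f → θ (π i) = X i * e i)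
    (hθf : θ (π f) = X f * e f + G) (he : ∀ i, constantCoeff (e i) ≠ 0) (hG0 : constantCoeff G = 0)
    (hG1 : coeff (Finsupp.single f 1) G = 0) (hlin : ∀ i, i ≠ f → coeff (Finsupp.single i 1) G = 0)
    {V D F_A F_B : MvPolynomial (Fin 4) K} {M : ℕ}
    (hV : constantCoeff V ≠ 0) (hD : D ∈ originIdeal K ^ M) (hrel : F_B = deletePthPowers q (V * aeval θ F_A) + D)
    {r : Fin 4 →₀ ℕ} {d : ℕ} (hd : 1 ≤ d) (hdK : (d : K) ≠ 0) (hrf : r (π f) = 0)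
    (hA : ∀ m ∈ F_A.support, r.degree + d ≤ m.degree)
    (hAcone : ∀ m ∈ F_A.support, m.degree = r.degree + d → m = r + Finsupp.single (π f) d)
    (ha : coeff (r + Finsupp.single (π f) d) F_A ≠ 0) (hM : r.degree + d + 1 < M)
    (hA4 : ∀ i k, i ≠ f → k ≠ f →
      coeff (r + Finsupp.single (π f) (d - 1) + Finsupp.single (π i) 1 + Finsupp.single (π k) 1) F_A = 0)
    (hnq : ∀ i k, i ≠ f → k ≠ f → ¬ IsPthPowerExponent q
      (Finsupp.mapDomain π.symm r + Finsupp.single f (d - 1) + Finsupp.single i 1 + Finsupp.single k 1))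
    (hB4 : ∀ i k, i ≠ f → k ≠ f →
      coeff (Finsupp.mapDomain π.symm r + Finsupp.single f (d - 1) + Finsupp.single i 1 + Finsupp.single k 1) F_B = 0) :
    ∀ i k, i ≠ f → k ≠ f → coeff (Finsupp.single i 1 + Finsupp.single k 1) G = 0 := by
  classical
  intro i k hif hkf
  have hθ0 := unitClass_origin hθi hθf hG0
  have hG2 := coeff_eq_zero_of_degree_lt_two hG0 hG1 hlin
  have hGs : ∀ dd ∈ G.support, dd f = 0 → 2 ≤ dd.degree := two_le_degree_of_linearFree hG0 hlin
  set ms := r + Finsupp.single (π f) d with hms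
  set a := coeff ms F_A with ha'
  set w := Finsupp.single i 1 + Finsupp.single k 1 with hw
  have hwf : w f = 0 := by
    rw [hw, Finsupp.add_apply, Finsupp.single_eq_of_ne hif.symm, Finsupp.single_eq_of_ne hkf.symm, add_zero]
  have hwdeg : w.degree = 2 := by rw [hw, map_add, Finsupp.degree_single, Finsupp.degree_single]
  set t := Finsupp.mapDomain π.symm r + Finsupp.single f (d - 1) + Finsupp.single i 1 + Finsupp.single k 1 with ht
  have ht' : t = Finsupp.mapDomain π.symm r + (Finsupp.single f (d - 1) + w) := by rw [ht, hw]; abel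
  have htf : t f = d - 1 := by
    rw [ht', Finsupp.add_apply, Finsupp.add_apply, ResCone.mapDomain_symm_apply, hrf, Finsupp.single_eq_same, hwf]
    omega
  have htdeg : t.degree = r.degree + d + 1 := by
    rw [ht', map_add, map_add, ResCone.degree_mapDomain_perm, Finsupp.degree_single, hwdeg]; omega
  -- the target in `A`-letters and the transfer hypothesis for the remainder
  set n := r + Finsupp.single (π f) (d - 1) + Finsupp.single (π i) 1 + Finsupp.single (π k) 1 with hn
  have hnt : Finsupp.mapDomain π.symm n = t := by
    rw [hn, ht]
    simp only [Finsupp.mapDomain_add, mapDomain_perm_single]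
  have hndeg : n.degree = r.degree + d + 1 := by rw [← ResCone.degree_mapDomain_perm π.symm n, hnt, htdeg]
  have hR : F_A - monomial ms a ∈ originIdeal K ^ (r.degree + d + 1) := sub_monomial_mem_pow hA hAcone
  -- (1) the remainder contributes `(∏ e(0)^n) · coeff_n F_A = 0` at `t`
  have hRt : coeff t (aeval θ (F_A - monomial ms a)) = 0 := by
    rw [← hnt, coeff_aeval_unitClass hθi hθf hG1 hGs (by norm_num) (F_A - monomial ms a) (n := n)
      (fun m₀ j hle hdeg hne => (IsolationCert.mem_originIdeal_pow_iff _ _).mp hR _ (by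
        rw [map_add, Finsupp.degree_single]
        rcases Nat.eq_zero_or_pos j with rfl | hj
        · rw [Finsupp.single_zero, add_zero] at hne
          have := degree_lt_of_le_of_ne hle hne; omega
        · omega))]
    have h4 : coeff n F_A = 0 := hA4 i k hif hkf
    rw [coeff_sub, coeff_monomial, if_neg (fun h => by
      have := congrArg Finsupp.degree h
      rw [hms, map_add, Finsupp.degree_single, hndeg] at this; omega), sub_zero, h4, mul_zero]
  -- (2) `θ F_A` has nothing strictly below `t`: order `|r|+d`, and its degree-(|r|+d) part is the single monomial
  --     `x^{r♯ + d e_f}` (support of `θ(cone)` with `s = 2`), whose `f`-exponent `d` exceeds `t_f = d − 1`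
  have hθA : ∀ b : Fin 4 →₀ ℕ, b.degree < r.degree + d → coeff b (aeval θ F_A) = 0 := fun b hb =>
    (IsolationCert.mem_originIdeal_pow_iff _ _).mp
      (aeval_mem_pow hθ0 ((IsolationCert.mem_originIdeal_pow_iff _ F_A).mpr fun dd hdd => by
        by_contra hne; exact absurd (hA dd (mem_support_iff.mpr hne)) (by omega))) b hb
  have hlowt : ∀ b ≤ t, b ≠ t → coeff b (aeval θ F_A) = 0 := by
    intro b hb hbt
    have hbdeg := degree_lt_of_le_of_ne hb hbt
    rw [htdeg] at hbdeg
    rcases Nat.lt_or_ge b.degree (r.degree + d) with hlt | hge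
    · exact hθA b hlt
    · have hbd : b.degree = r.degree + d := by omega
      have hsplit : F_A = monomial ms a + (F_A - monomial ms a) := by ring
      rw [hsplit, map_add, coeff_add,
        (IsolationCert.mem_originIdeal_pow_iff _ _).mp (aeval_mem_pow hθ0 hR) b (by omega), add_zero]
      by_contra hne
      obtain ⟨i', j', hij', hle', hdeg'⟩ :=
        support_aeval_monomial hθi hθf hGs (by norm_num) ms a b (mem_support_iff.mpr hne)
      rw [hms, Finsupp.add_apply, hrf, Finsupp.single_eq_same, zero_add] at hij'
      rw [hms, erase_add_single_self hrf] at hle' hdeg'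
      have hj0 : j' = 0 := by omega
      subst hj0
      rw [add_zero] at hij'
      subst hij'
      have hbf : Finsupp.mapDomain π.symm r f + i' ≤ b f := by
        have := Finsupp.le_def.mp hle' f
        rwa [Finsupp.add_apply, Finsupp.single_eq_same] at this
      have hbf' : b f ≤ t f := Finsupp.le_def.mp hb f
      rw [htf] at hbf'
      omega
  -- (3) assemble
  have h1 : coeff t F_B = constantCoeff V * coeff t (aeval θ F_A) :=
    coeff_of_rel_of_lower q hD hrel (by omega) (hnq i k hif hkf) hlowt
  have h2 : coeff t (aeval θ F_A) = coeff t (aeval θ (monomial ms a)) := by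
    have hsplit : F_A = monomial ms a + (F_A - monomial ms a) := by ring
    conv_lhs => rw [hsplit, map_add, coeff_add, hRt, add_zero]
  have h3 : coeff t (aeval θ (monomial ms a)) =
      a * (d * (constantCoeff (∏ i ∈ univ.erase f, e i ^ r (π i)) * constantCoeff (e f) ^ (d - 1) * coeff w G)) := by
    rw [hms, aeval_cone_monomial hθi hθf hrf, coeff_C_mul, mul_assoc, ht', coeff_monomial_mul, one_mul,
      coeff_pred_mul_X_mul_add_pow f _ (e f) G hd hwf (fun v hv => hG2 v (by rw [hwdeg] at hv; exact hv))
        (fun H k v hk _ hdeg _ => hvan_of_mem_sq hG2 H k v hk (by rw [hwdeg] at hdeg; exact hdeg))]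
  have hE : ∏ i ∈ univ.erase f, constantCoeff (e i) ^ r (π i) ≠ 0 :=
    prod_ne_zero_iff.mpr fun j _ => pow_ne_zero _ (he j)
  have h := hB4 i k hif hkf
  rw [h1, h2, h3] at h
  simpa [hV, ha, hdK, hE, he f] using h

/-- **`s = 3` FOR THE TRANSFER THEOREM**: under §1 + §2 (both ends straight in degree `|r|+d` and Tschirnhaus in degree
`|r|+d+1`), every `x_f`-free monomial of `G` has degree `≥ 3` — the hypothesis `hG` of `SwapNorm.coeff_aeval_unitClass` /
`coeff_of_unitClass_rel` with `s = 3`. [folklore] -/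
theorem three_le_degree_of_frames {G : MvPolynomial (Fin 4) K} {f : Fin 4} (hG0 : constantCoeff G = 0)
    (hlin : ∀ i, i ≠ f → coeff (Finsupp.single i 1) G = 0)
    (hquad : ∀ i k, i ≠ f → k ≠ f → coeff (Finsupp.single i 1 + Finsupp.single k 1) G = 0) :
    ∀ dd ∈ G.support, dd f = 0 → 3 ≤ dd.degree := by
  classical
  intro dd hdd hddf
  have h2 := two_le_degree_of_linearFree hG0 hlin dd hdd hddf
  by_contra hlt
  have hdeg : dd.degree = 2 := by omega
  -- `dd = e_i + e_k` with `i, k ≠ f`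
  have hne : dd ≠ 0 := by rintro rfl; rw [map_zero] at hdeg; exact absurd hdeg (by norm_num)
  obtain ⟨i, hi⟩ : ∃ i, dd i ≠ 0 := by
    by_contra h; push Not at h; exact hne (Finsupp.ext h)
  have hif : i ≠ f := by rintro rfl; exact hi hddf
  have hle : Finsupp.single i 1 ≤ dd := Finsupp.single_le_iff.mpr (Nat.one_le_iff_ne_zero.mpr hi)
  have hsplit : Finsupp.single i 1 + (dd - Finsupp.single i 1) = dd := add_tsub_cancel_of_le hle
  have hdeg1 : (dd - Finsupp.single i 1).degree = 1 := by
    have h := congrArg Finsupp.degree hsplit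
    rw [map_add, Finsupp.degree_single, hdeg] at h; omega
  obtain ⟨k, hk⟩ := IsolationCert.exists_eq_single_of_degree_eq_one hdeg1
  have hkf : k ≠ f := by
    rintro rfl
    have h := DFunLike.congr_fun hk k
    rw [Finsupp.tsub_apply, hddf, Finsupp.single_eq_same] at h
    omega
  rw [hk] at hsplit
  exact (mem_support_iff.mp hdd) (by rw [← hsplit]; exact hquad i k hif hkf)

end Frames

end SwapNorm

end Summit.ResolutionOfSingularities.ResolutionOfSingularities.Theorems.PIDim4

end
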